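import Summits.Ventures.PercRepro2.CaseOneGlueMarks
import Summits.Ventures.PercRepro2.CaseOneDegenerate

/-!
# The faces that move a mark onto the statement vertex
(blind cell PercRepro2, p1 g17; S5 (S5.a″) (n): the index-`3` faces at the marks)

`CaseOneGlueMarks.lean` moves the marks `o`, `b` and the statement vertex `a₃` along an edge of weight
`1`; `CaseOneDegenerate.lean` proves every case-1 form when `a₃` coincides with a mark. Together:
`zSplitII_of_b_glued` (an edge `{b, a₃}` of weight `1`: the mark `b` moves onto `a₃` and
`zSplitII_of_b_eq_a3` applies), `zSplitII_of_o_glued`, `zSplitII_of_a1_glued`, `zSplitII_of_a2_glued`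
and the `(i)`, `(ii-Q)`, `(i-Q)` versions — the face `e(a₃–m) = 3` of every gadget with an edge from
the statement vertex to a mark `m` is a theorem. Own code; standard axioms. -/

namespace Summit.Ventures.PercRepro2

namespace CaseOne

/-! ## The faces that move a mark onto `a₃` -/

section MarkGlued
variable {V : Type*} {E : Type*} [Fintype E] [DecidableEq E] [Fintype V] [DecidableEq V]
  {R : Type*} [Field R] [LinearOrder R] [IsStrictOrderedRing R]
variable {ends : E → Sym2 V} {e : E}

/-- **An edge `{b, a₃}` of weight `1`**: `(ii)` holds (the mark `b` moves onto `a₃`). -/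
theorem zSplitII_of_b_glued (p : E → R) (hp : IsProbVec p) (he : p e = 1) {b a₃ : V}
    (hends : ends e = s(b, a₃)) (o a₁ a₂ : V) : ZSplitII p ends o a₁ a₂ a₃ b :=
  (zSplitII_glue_b he hends o a₁ a₂ a₃).2 (zSplitII_of_b_eq_a3 p hp o a₁ a₂ a₃)

/-- **An edge `{b, a₃}` of weight `1`**: `(i)` holds. -/
theorem zSplitI_of_b_glued (p : E → R) (hp : IsProbVec p) (he : p e = 1) {b a₃ : V}
    (hends : ends e = s(b, a₃)) (o a₁ a₂ : V) : ZSplitI p ends o a₁ a₂ a₃ b :=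
  (zSplitI_glue_b he hends o a₁ a₂ a₃).2 (zSplitI_of_b_eq_a3 p hp o a₁ a₂ a₃)

/-- **An edge `{b, a₃}` of weight `1`**: `(ii-Q)` holds. -/
theorem zSplitIIQ_of_b_glued (p : E → R) (hp : IsProbVec p) (he : p e = 1) {b a₃ : V}
    (hends : ends e = s(b, a₃)) (o a₁ a₂ : V) : ZSplitIIQ p ends o a₁ a₂ a₃ b :=
  (zSplitIIQ_glue_b he hends o a₁ a₂ a₃).2 (zSplitIIQ_of_b_eq_a3 p hp o a₁ a₂ a₃)

/-- **An edge `{b, a₃}` of weight `1`**: `(i-Q)` holds. -/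
theorem zSplitIQ_of_b_glued (p : E → R) (hp : IsProbVec p) (he : p e = 1) {b a₃ : V}
    (hends : ends e = s(b, a₃)) (o a₁ a₂ : V) : ZSplitIQ p ends o a₁ a₂ a₃ b :=
  (zSplitIQ_glue_b he hends o a₁ a₂ a₃).2 (zSplitIQ_of_b_eq_a3 p hp o a₁ a₂ a₃)

/-- **An edge `{o, a₃}` of weight `1`**: `(ii)` holds (the mark `o` moves onto `a₃`). -/
theorem zSplitII_of_o_glued (p : E → R) (hp : IsProbVec p) (he : p e = 1) {o a₃ : V}
    (hends : ends e = s(o, a₃)) (a₁ a₂ b : V) : ZSplitII p ends o a₁ a₂ a₃ b :=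
  (zSplitII_glue_o he hends a₁ a₂ a₃ b).2 (zSplitII_of_o_eq_a3 p hp a₁ a₂ a₃ b)

/-- **An edge `{o, a₃}` of weight `1`**: `(i)` holds. -/
theorem zSplitI_of_o_glued (p : E → R) (hp : IsProbVec p) (he : p e = 1) {o a₃ : V}
    (hends : ends e = s(o, a₃)) (a₁ a₂ b : V) : ZSplitI p ends o a₁ a₂ a₃ b :=
  (zSplitI_glue_o he hends a₁ a₂ a₃ b).2 (zSplitI_of_o_eq_a3 p hp a₁ a₂ a₃ b)

/-- **An edge `{o, a₃}` of weight `1`**: `(ii-Q)` holds. -/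
theorem zSplitIIQ_of_o_glued (p : E → R) (hp : IsProbVec p) (he : p e = 1) {o a₃ : V}
    (hends : ends e = s(o, a₃)) (a₁ a₂ b : V) : ZSplitIIQ p ends o a₁ a₂ a₃ b :=
  (zSplitIIQ_glue_o he hends a₁ a₂ a₃ b).2 (zSplitIIQ_of_o_eq_a3 p hp a₁ a₂ a₃ b)

/-- **An edge `{o, a₃}` of weight `1`**: `(i-Q)` holds. -/
theorem zSplitIQ_of_o_glued (p : E → R) (hp : IsProbVec p) (he : p e = 1) {o a₃ : V}
    (hends : ends e = s(o, a₃)) (a₁ a₂ b : V) : ZSplitIQ p ends o a₁ a₂ a₃ b :=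
  (zSplitIQ_glue_o he hends a₁ a₂ a₃ b).2 (zSplitIQ_of_o_eq_a3 p hp a₁ a₂ a₃ b)

/-- **An edge `{a₃, a₁}` of weight `1`**: `(ii)` holds (`a₃` moves onto the root `a₁`). -/
theorem zSplitII_of_a1_glued (p : E → R) (hp : IsProbVec p) (he : p e = 1) {a₁ a₃ : V}
    (hends : ends e = s(a₃, a₁)) (o a₂ b : V) : ZSplitII p ends o a₁ a₂ a₃ b :=
  (zSplitII_glue_a3 he hends o a₁ a₂ b).2 (zSplitII_of_a1_eq_a3 p hp o a₁ a₂ b)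

/-- **An edge `{a₃, a₁}` of weight `1`**: `(i)` holds. -/
theorem zSplitI_of_a1_glued (p : E → R) (hp : IsProbVec p) (he : p e = 1) {a₁ a₃ : V}
    (hends : ends e = s(a₃, a₁)) (o a₂ b : V) : ZSplitI p ends o a₁ a₂ a₃ b :=
  (zSplitI_glue_a3 he hends o a₁ a₂ b).2 (zSplitI_of_a1_eq_a3 p hp o a₁ a₂ b)

/-- **An edge `{a₃, a₁}` of weight `1`**: `(ii-Q)` holds. -/
theorem zSplitIIQ_of_a1_glued (p : E → R) (hp : IsProbVec p) (he : p e = 1) {a₁ a₃ : V}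
    (hends : ends e = s(a₃, a₁)) (o a₂ b : V) : ZSplitIIQ p ends o a₁ a₂ a₃ b :=
  (zSplitIIQ_glue_a3 he hends o a₁ a₂ b).2 (zSplitIIQ_of_a1_eq_a3 p hp o a₁ a₂ b)

/-- **An edge `{a₃, a₁}` of weight `1`**: `(i-Q)` holds. -/
theorem zSplitIQ_of_a1_glued (p : E → R) (hp : IsProbVec p) (he : p e = 1) {a₁ a₃ : V}
    (hends : ends e = s(a₃, a₁)) (o a₂ b : V) : ZSplitIQ p ends o a₁ a₂ a₃ b :=
  (zSplitIQ_glue_a3 he hends o a₁ a₂ b).2 (zSplitIQ_of_a1_eq_a3 p hp o a₁ a₂ b)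

omit [Fintype V] [DecidableEq V] [IsStrictOrderedRing R] in
/-- **An edge `{a₃, a₂}` of weight `1`**: `(ii)` holds (`a₃` moves onto the root `a₂`). -/
theorem zSplitII_of_a2_glued (p : E → R) (he : p e = 1) {a₂ a₃ : V}
    (hends : ends e = s(a₃, a₂)) (o a₁ b : V) : ZSplitII p ends o a₁ a₂ a₃ b :=
  (zSplitII_glue_a3 he hends o a₁ a₂ b).2 (zSplitII_of_a2_eq_a3 p o a₁ a₂ b)

omit [Fintype V] [DecidableEq V] [IsStrictOrderedRing R] in
/-- **An edge `{a₃, a₂}` of weight `1`**: `(i)` holds. -/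
theorem zSplitI_of_a2_glued (p : E → R) (he : p e = 1) {a₂ a₃ : V}
    (hends : ends e = s(a₃, a₂)) (o a₁ b : V) : ZSplitI p ends o a₁ a₂ a₃ b :=
  (zSplitI_glue_a3 he hends o a₁ a₂ b).2 (zSplitI_of_a2_eq_a3 p o a₁ a₂ b)

omit [Fintype V] [DecidableEq V] [IsStrictOrderedRing R] in
/-- **An edge `{a₃, a₂}` of weight `1`**: `(ii-Q)` holds. -/
theorem zSplitIIQ_of_a2_glued (p : E → R) (he : p e = 1) {a₂ a₃ : V}
    (hends : ends e = s(a₃, a₂)) (o a₁ b : V) : ZSplitIIQ p ends o a₁ a₂ a₃ b :=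
  (zSplitIIQ_glue_a3 he hends o a₁ a₂ b).2 (zSplitIIQ_of_a2_eq_a3 p o a₁ a₂ b)

omit [Fintype V] [DecidableEq V] [IsStrictOrderedRing R] in
/-- **An edge `{a₃, a₂}` of weight `1`**: `(i-Q)` holds. -/
theorem zSplitIQ_of_a2_glued (p : E → R) (he : p e = 1) {a₂ a₃ : V}
    (hends : ends e = s(a₃, a₂)) (o a₁ b : V) : ZSplitIQ p ends o a₁ a₂ a₃ b :=
  (zSplitIQ_glue_a3 he hends o a₁ a₂ b).2 (zSplitIQ_of_a2_eq_a3 p o a₁ a₂ b)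

end MarkGlued

end CaseOne

end Summit.Ventures.PercRepro2
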